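import Summits.BirchSwinnertonDyer.Rank1Residual.Additive.X3ThreeLineDatum
import Summits.BirchSwinnertonDyer.Rank1Residual.X2.CellAGVParCertificatesN9A
import Mathlib.Tactic.Simproc.Factors
import HarnessLib

/-!
# X3♯(G-ord, `e = 2`) at `p = 3`: kernel records of the per-pair LINE DATUM `X3LineDatumThree W` for the
# Case-1 members of the B-X3G booking list — part K of 16 (cell `bsd-addord`, seat
# `bsd-addord-twist`, strategy = twist transport)

HONEST FRAMING (cell `bsd-addord`, `run/shared/lean/pub/bsd-addord/README.md` §4): the programme's
target of record is the full Birch–Swinnerton-Dyer formula for every `E/ℚ` of analytic rank `≤ 1`.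
DATA-RECORDS module: theorems only (no definition, no named fact, no `sorry`); it BOOKS NOTHING and
moves no mark — booking is the planner's act (TARGET.md v5.5 §8 protocol B-X3G, (iv)).

## What is recorded

For each isogeny class `(N, class, 3)` of the booking list `HOME/bsd-addord-twist-booking-members.tsv`
(kit job j242057; the r_an = 0, non-CM, non-degenerate branch-parity classes of cell (G-ord, `e = 2`) at
`p = 3` in census v2, planner keys `HOME/planner/bx3g/`), the CASE-1 MEMBER `W = [a₁, a₂, a₃, a₄, a₆]`
(Cremona's globally minimal model; the first member in Cremona order carrying the EVEN rational `3`-line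
as a SUB-line) and the theorem `X3LineDatumThree W` — SOME rational `3`-line `Φ₀ ≤ W[3]` which is even,
has non-trivial `Γ_ℚ`-action and `χ_{−3}`-twist ramified at `3` — proved by
`x3LineDatumThree_of_cert_of_delta` from the certificate `(x₀, s, D, q)`: `Ψ₃(x₀) = 0`, `D` squarefree,
`s ≠ 0`, `D·s² = Ψ₂Sq(x₀)`, `0 < D`, `D ≠ 1`, `3 ∤ D` (`norm_num` identities, one prime-factor-list
computation with X2a's helper `squarefree_of_nodup_primeFactorsList_natAbs`, `decide`s). This is the per-pair line-datum input of
`ClassX3Gord.{{missingLowerBoundAt,bsdp}}_three_rankZero_of_facts_of_nonAnomalous`; the class binders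
(`ClassX3Gord W 3`, `¬ HasCM`, `analyticRank = 0`, `ReductionNonAnomalous W 3`) are data of record
(Cremona / the planner's two-engine census), NOT kernel statements here; the other members of each class
are reached by Cassels (`N10.bsdp_of_isIsogenous_of_bsdp`, binder `bsdRHS_eq_of_isIsogenous`). The
docstring of each record names the class, the anomalous bit of the twist `V = W ⊗ χ_{−3}` and `D`
(`φ = χ_D`). Records sorted by conductor.

References: [GreenbergVatsal2000] §2 p. 28 (the line `Φ`); lane file
`HOME/bsd-addord-twist-booking-members.tsv`; `Additive/X3ThreeLineDatum.lean`.
-/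

set_option autoImplicit false

open WeierstrassCurve Polynomial Literature.NumberTheory.EllipticCurves
  Literature.NumberTheory.EllipticCurves.Rank1Residual

namespace Summit.BirchSwinnertonDyer.Rank1Residual.Additive.X3ThreeLineDatumRecords

/-- `300150bz2` = `[1,-1,0,-10787517,13847731141]` (class `300150bz`, (G-ord, `e = 2`) at `3`; twist `33350k2`, `a₃(V) = -1`, non-anomalous; even line
`φ = χ_{5}`): `x₀ = 1354`, `D = 5`, `s = 37120`, `Ψ₂Sq(x₀) = 6889472000` ⇒ `X3LineDatumThree W`. [folklore] -/
theorem x3LineDatumThree_300150bz2 : X3LineDatumThree (⟨1, -1, 0, -10787517, 13847731141⟩ : WeierstrassCurve ℚ) :=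
  x3LineDatumThree_of_cert_of_delta _ (by norm_num [Δ, b₂, b₄, b₆, b₈]) 1354 37120 5
    (by simp only [Ψ₃, eval_add, eval_mul, eval_pow, eval_C, eval_X, eval_ofNat]; norm_num [b₂, b₄, b₆, b₈])
    (X2.CellACertN9.squarefree_of_nodup_primeFactorsList_natAbs (by norm_num) (by simp [Nat.primeFactorsList_ofNat])) (by norm_num)
    (by rw [KernelDisc.eval_Ψ₂Sq]; norm_num [b₂, b₄, b₆]) (by decide) (by decide) (by decide)

/-- `300150x2` = `[1,-1,0,-3400317,2393942341]` (class `300150x`, (G-ord, `e = 2`) at `3`; twist `33350o2`, `a₃(V) = -1`, non-anomalous; even line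
`φ = χ_{5}`): `x₀ = 1354`, `D = 5`, `s = 14720`, `Ψ₂Sq(x₀) = 1083392000` ⇒ `X3LineDatumThree W`. [folklore] -/
theorem x3LineDatumThree_300150x2 : X3LineDatumThree (⟨1, -1, 0, -3400317, 2393942341⟩ : WeierstrassCurve ℚ) :=
  x3LineDatumThree_of_cert_of_delta _ (by norm_num [Δ, b₂, b₄, b₆, b₈]) 1354 14720 5
    (by simp only [Ψ₃, eval_add, eval_mul, eval_pow, eval_C, eval_X, eval_ofNat]; norm_num [b₂, b₄, b₆, b₈])
    (X2.CellACertN9.squarefree_of_nodup_primeFactorsList_natAbs (by norm_num) (by simp [Nat.primeFactorsList_ofNat])) (by norm_num)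
    (by rw [KernelDisc.eval_Ψ₂Sq]; norm_num [b₂, b₄, b₆]) (by decide) (by decide) (by decide)

/-- `301950u2` = `[1,-1,0,-936792,348840616]` (class `301950u`, (G-ord, `e = 2`) at `3`; twist `33550s2`, `a₃(V) = -1`, non-anomalous; even line
`φ = χ_{5}`): `x₀ = 634`, `D = 5`, `s = 2750`, `Ψ₂Sq(x₀) = 37812500` ⇒ `X3LineDatumThree W`. [folklore] -/
theorem x3LineDatumThree_301950u2 : X3LineDatumThree (⟨1, -1, 0, -936792, 348840616⟩ : WeierstrassCurve ℚ) :=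
  x3LineDatumThree_of_cert_of_delta _ (by norm_num [Δ, b₂, b₄, b₆, b₈]) 634 2750 5
    (by simp only [Ψ₃, eval_add, eval_mul, eval_pow, eval_C, eval_X, eval_ofNat]; norm_num [b₂, b₄, b₆, b₈])
    (X2.CellACertN9.squarefree_of_nodup_primeFactorsList_natAbs (by norm_num) (by simp [Nat.primeFactorsList_ofNat])) (by norm_num)
    (by rw [KernelDisc.eval_Ψ₂Sq]; norm_num [b₂, b₄, b₆]) (by decide) (by decide) (by decide)

/-- `302175z2` = `[0,0,1,-70050,8862781]` (class `302175z`, (G-ord, `e = 2`) at `3`; twist `33575c2`, `a₃(V) = 2`, non-anomalous; even line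
`φ = χ_{5}`): `x₀ = 60`, `D = 5`, `s = 1975`, `Ψ₂Sq(x₀) = 19503125` ⇒ `X3LineDatumThree W`. [folklore] -/
theorem x3LineDatumThree_302175z2 : X3LineDatumThree (⟨0, 0, 1, -70050, 8862781⟩ : WeierstrassCurve ℚ) :=
  x3LineDatumThree_of_cert_of_delta _ (by norm_num [Δ, b₂, b₄, b₆, b₈]) 60 1975 5
    (by simp only [Ψ₃, eval_add, eval_mul, eval_pow, eval_C, eval_X, eval_ofNat]; norm_num [b₂, b₄, b₆, b₈])
    (X2.CellACertN9.squarefree_of_nodup_primeFactorsList_natAbs (by norm_num) (by simp [Nat.primeFactorsList_ofNat])) (by norm_num)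
    (by rw [KernelDisc.eval_Ψ₂Sq]; norm_num [b₂, b₄, b₆]) (by decide) (by decide) (by decide)

/-- `303408ck2` = `[0,0,0,29400,-525476]` (class `303408ck`, (G-ord, `e = 2`) at `3`; twist `33712m2`, `a₃(V) = -2` — ANOMALOUS (outside the end state as typed); even line
`φ = χ_{7}`): `x₀ = 84`, `D = 7`, `s = 1204`, `Ψ₂Sq(x₀) = 10147312` ⇒ `X3LineDatumThree W`. [folklore] -/
theorem x3LineDatumThree_303408ck2 : X3LineDatumThree (⟨0, 0, 0, 29400, -525476⟩ : WeierstrassCurve ℚ) :=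
  x3LineDatumThree_of_cert_of_delta _ (by norm_num [Δ, b₂, b₄, b₆, b₈]) 84 1204 7
    (by simp only [Ψ₃, eval_add, eval_mul, eval_pow, eval_C, eval_X, eval_ofNat]; norm_num [b₂, b₄, b₆, b₈])
    (X2.CellACertN9.squarefree_of_nodup_primeFactorsList_natAbs (by norm_num) (by simp [Nat.primeFactorsList_ofNat])) (by norm_num)
    (by rw [KernelDisc.eval_Ψ₂Sq]; norm_num [b₂, b₄, b₆]) (by decide) (by decide) (by decide)

/-- `303552bo2` = `[0,0,0,-4260,-514168]` (class `303552bo`, (G-ord, `e = 2`) at `3`; twist `33728d2`, `a₃(V) = -1`, non-anomalous; even line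
`φ = χ_{2}`): `x₀ = 150`, `D = 2`, `s = 2108`, `Ψ₂Sq(x₀) = 8887328` ⇒ `X3LineDatumThree W`. [folklore] -/
theorem x3LineDatumThree_303552bo2 : X3LineDatumThree (⟨0, 0, 0, -4260, -514168⟩ : WeierstrassCurve ℚ) :=
  x3LineDatumThree_of_cert_of_delta _ (by norm_num [Δ, b₂, b₄, b₆, b₈]) 150 2108 2
    (by simp only [Ψ₃, eval_add, eval_mul, eval_pow, eval_C, eval_X, eval_ofNat]; norm_num [b₂, b₄, b₆, b₈])
    Int.prime_two.squarefree (by norm_num)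
    (by rw [KernelDisc.eval_Ψ₂Sq]; norm_num [b₂, b₄, b₆]) (by decide) (by decide) (by decide)

/-- `304704dp2` = `[0,0,0,-349140,97043992]` (class `304704dp`, (G-ord, `e = 2`) at `3`; twist `33856be2`, `a₃(V) = 1` — ANOMALOUS (outside the end state as typed); even line
`φ = χ_{46}`): `x₀ = 138`, `D = 46`, `s = 2116`, `Ψ₂Sq(x₀) = 205962976` ⇒ `X3LineDatumThree W`. [folklore] -/
theorem x3LineDatumThree_304704dp2 : X3LineDatumThree (⟨0, 0, 0, -349140, 97043992⟩ : WeierstrassCurve ℚ) :=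
  x3LineDatumThree_of_cert_of_delta _ (by norm_num [Δ, b₂, b₄, b₆, b₈]) 138 2116 46
    (by simp only [Ψ₃, eval_add, eval_mul, eval_pow, eval_C, eval_X, eval_ofNat]; norm_num [b₂, b₄, b₆, b₈])
    (X2.CellACertN9.squarefree_of_nodup_primeFactorsList_natAbs (by norm_num) (by simp [Nat.primeFactorsList_ofNat])) (by norm_num)
    (by rw [KernelDisc.eval_Ψ₂Sq]; norm_num [b₂, b₄, b₆]) (by decide) (by decide) (by decide)

/-- `304704p2` = `[0,0,0,-65964,6522064]` (class `304704p`, (G-ord, `e = 2`) at `3`; twist `33856bn2`, `a₃(V) = -2` — ANOMALOUS (outside the end state as typed); even line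
`φ = χ_{46}`): `x₀ = 138`, `D = 46`, `s = 64`, `Ψ₂Sq(x₀) = 188416` ⇒ `X3LineDatumThree W`. [folklore] -/
theorem x3LineDatumThree_304704p2 : X3LineDatumThree (⟨0, 0, 0, -65964, 6522064⟩ : WeierstrassCurve ℚ) :=
  x3LineDatumThree_of_cert_of_delta _ (by norm_num [Δ, b₂, b₄, b₆, b₈]) 138 64 46
    (by simp only [Ψ₃, eval_add, eval_mul, eval_pow, eval_C, eval_X, eval_ofNat]; norm_num [b₂, b₄, b₆, b₈])
    (X2.CellACertN9.squarefree_of_nodup_primeFactorsList_natAbs (by norm_num) (by simp [Nat.primeFactorsList_ofNat])) (by norm_num)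
    (by rw [KernelDisc.eval_Ψ₂Sq]; norm_num [b₂, b₄, b₆]) (by decide) (by decide) (by decide)

/-- `305550ba2` = `[1,-1,0,1413,41341]` (class `305550ba`, (G-ord, `e = 2`) at `3`; twist `33950r2`, `a₃(V) = -1`, non-anomalous; even line
`φ = χ_{5}`): `x₀ = 4`, `D = 5`, `s = 194`, `Ψ₂Sq(x₀) = 188180` ⇒ `X3LineDatumThree W`. [folklore] -/
theorem x3LineDatumThree_305550ba2 : X3LineDatumThree (⟨1, -1, 0, 1413, 41341⟩ : WeierstrassCurve ℚ) :=
  x3LineDatumThree_of_cert_of_delta _ (by norm_num [Δ, b₂, b₄, b₆, b₈]) 4 194 5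
    (by simp only [Ψ₃, eval_add, eval_mul, eval_pow, eval_C, eval_X, eval_ofNat]; norm_num [b₂, b₄, b₆, b₈])
    (X2.CellACertN9.squarefree_of_nodup_primeFactorsList_natAbs (by norm_num) (by simp [Nat.primeFactorsList_ofNat])) (by norm_num)
    (by rw [KernelDisc.eval_Ψ₂Sq]; norm_num [b₂, b₄, b₆]) (by decide) (by decide) (by decide)

/-- `305550z2` = `[1,-1,0,-57492,-9690584]` (class `305550z`, (G-ord, `e = 2`) at `3`; twist `33950q2`, `a₃(V) = -1`, non-anomalous; even line
`φ = χ_{5}`): `x₀ = 454`, `D = 5`, `s = 6790`, `Ψ₂Sq(x₀) = 230520500` ⇒ `X3LineDatumThree W`. [folklore] -/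
theorem x3LineDatumThree_305550z2 : X3LineDatumThree (⟨1, -1, 0, -57492, -9690584⟩ : WeierstrassCurve ℚ) :=
  x3LineDatumThree_of_cert_of_delta _ (by norm_num [Δ, b₂, b₄, b₆, b₈]) 454 6790 5
    (by simp only [Ψ₃, eval_add, eval_mul, eval_pow, eval_C, eval_X, eval_ofNat]; norm_num [b₂, b₄, b₆, b₈])
    (X2.CellACertN9.squarefree_of_nodup_primeFactorsList_natAbs (by norm_num) (by simp [Nat.primeFactorsList_ofNat])) (by norm_num)
    (by rw [KernelDisc.eval_Ψ₂Sq]; norm_num [b₂, b₄, b₆]) (by decide) (by decide) (by decide)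

/-- `308025be2` = `[0,0,1,-7187250,7181645656]` (class `308025be`, (G-ord, `e = 2`) at `3`; twist `34225b2`, `a₃(V) = -1`, non-anomalous; even line
`φ = χ_{185}`): `x₀ = 2220`, `D = 185`, `s = 6845`, `Ψ₂Sq(x₀) = 8667994625` ⇒ `X3LineDatumThree W`. [folklore] -/
theorem x3LineDatumThree_308025be2 : X3LineDatumThree (⟨0, 0, 1, -7187250, 7181645656⟩ : WeierstrassCurve ℚ) :=
  x3LineDatumThree_of_cert_of_delta _ (by norm_num [Δ, b₂, b₄, b₆, b₈]) 2220 6845 185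
    (by simp only [Ψ₃, eval_add, eval_mul, eval_pow, eval_C, eval_X, eval_ofNat]; norm_num [b₂, b₄, b₆, b₈])
    (X2.CellACertN9.squarefree_of_nodup_primeFactorsList_natAbs (by norm_num) (by simp [Nat.primeFactorsList_ofNat])) (by norm_num)
    (by rw [KernelDisc.eval_Ψ₂Sq]; norm_num [b₂, b₄, b₆]) (by decide) (by decide) (by decide)

/-- `308763t2` = `[0,0,1,-69186,7004403]` (class `308763t`, (G-ord, `e = 2`) at `3`; twist `34307e2`, `a₃(V) = -2` — ANOMALOUS (outside the end state as typed); even line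
`φ = χ_{13}`): `x₀ = 156`, `D = 13`, `s = 49`, `Ψ₂Sq(x₀) = 31213` ⇒ `X3LineDatumThree W`. [folklore] -/
theorem x3LineDatumThree_308763t2 : X3LineDatumThree (⟨0, 0, 1, -69186, 7004403⟩ : WeierstrassCurve ℚ) :=
  x3LineDatumThree_of_cert_of_delta _ (by norm_num [Δ, b₂, b₄, b₆, b₈]) 156 49 13
    (by simp only [Ψ₃, eval_add, eval_mul, eval_pow, eval_C, eval_X, eval_ofNat]; norm_num [b₂, b₄, b₆, b₈])
    (X2.CellACertN9.squarefree_of_nodup_primeFactorsList_natAbs (by norm_num) (by simp [Nat.primeFactorsList_ofNat])) (by norm_num)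
    (by rw [KernelDisc.eval_Ψ₂Sq]; norm_num [b₂, b₄, b₆]) (by decide) (by decide) (by decide)

/-- `310050cp3` = `[1,-1,0,-8880192,10171273216]` (class `310050cp`, (G-ord, `e = 2`) at `3`; twist `34450q3`, `a₃(V) = 2`, non-anomalous; even line
`φ = χ_{5}`): `x₀ = 1984`, `D = 5`, `s = 16960`, `Ψ₂Sq(x₀) = 1438208000` ⇒ `X3LineDatumThree W`. [folklore] -/
theorem x3LineDatumThree_310050cp3 : X3LineDatumThree (⟨1, -1, 0, -8880192, 10171273216⟩ : WeierstrassCurve ℚ) :=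
  x3LineDatumThree_of_cert_of_delta _ (by norm_num [Δ, b₂, b₄, b₆, b₈]) 1984 16960 5
    (by simp only [Ψ₃, eval_add, eval_mul, eval_pow, eval_C, eval_X, eval_ofNat]; norm_num [b₂, b₄, b₆, b₈])
    (X2.CellACertN9.squarefree_of_nodup_primeFactorsList_natAbs (by norm_num) (by simp [Nat.primeFactorsList_ofNat])) (by norm_num)
    (by rw [KernelDisc.eval_Ψ₂Sq]; norm_num [b₂, b₄, b₆]) (by decide) (by decide) (by decide)

/-- `310050s2` = `[1,-1,0,-792567,272021341]` (class `310050s`, (G-ord, `e = 2`) at `3`; twist `34450o2`, `a₃(V) = -1`, non-anomalous; even line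
`φ = χ_{5}`): `x₀ = 454`, `D = 5`, `s = 2120`, `Ψ₂Sq(x₀) = 22472000` ⇒ `X3LineDatumThree W`. [folklore] -/
theorem x3LineDatumThree_310050s2 : X3LineDatumThree (⟨1, -1, 0, -792567, 272021341⟩ : WeierstrassCurve ℚ) :=
  x3LineDatumThree_of_cert_of_delta _ (by norm_num [Δ, b₂, b₄, b₆, b₈]) 454 2120 5
    (by simp only [Ψ₃, eval_add, eval_mul, eval_pow, eval_C, eval_X, eval_ofNat]; norm_num [b₂, b₄, b₆, b₈])
    (X2.CellACertN9.squarefree_of_nodup_primeFactorsList_natAbs (by norm_num) (by simp [Nat.primeFactorsList_ofNat])) (by norm_num)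
    (by rw [KernelDisc.eval_Ψ₂Sq]; norm_num [b₂, b₄, b₆]) (by decide) (by decide) (by decide)

/-- `310050x2` = `[1,-1,0,-494285067,4566744518341]` (class `310050x`, (G-ord, `e = 2`) at `3`; twist `34450p2`, `a₃(V) = 2`, non-anomalous; even line
`φ = χ_{5}`): `x₀ = 6934`, `D = 5`, `s = 1085440`, `Ψ₂Sq(x₀) = 5890899968000` ⇒ `X3LineDatumThree W`. [folklore] -/
theorem x3LineDatumThree_310050x2 : X3LineDatumThree (⟨1, -1, 0, -494285067, 4566744518341⟩ : WeierstrassCurve ℚ) :=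
  x3LineDatumThree_of_cert_of_delta _ (by norm_num [Δ, b₂, b₄, b₆, b₈]) 6934 1085440 5
    (by simp only [Ψ₃, eval_add, eval_mul, eval_pow, eval_C, eval_X, eval_ofNat]; norm_num [b₂, b₄, b₆, b₈])
    (X2.CellACertN9.squarefree_of_nodup_primeFactorsList_natAbs (by norm_num) (by simp [Nat.primeFactorsList_ofNat])) (by norm_num)
    (by rw [KernelDisc.eval_Ψ₂Sq]; norm_num [b₂, b₄, b₆]) (by decide) (by decide) (by decide)

/-- `310275k2` = `[0,0,1,14100,997906]` (class `310275k`, (G-ord, `e = 2`) at `3`; twist `34475a2`, `a₃(V) = -1`, non-anomalous; even line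
`φ = χ_{5}`): `x₀ = 15`, `D = 5`, `s = 985`, `Ψ₂Sq(x₀) = 4851125` ⇒ `X3LineDatumThree W`. [folklore] -/
theorem x3LineDatumThree_310275k2 : X3LineDatumThree (⟨0, 0, 1, 14100, 997906⟩ : WeierstrassCurve ℚ) :=
  x3LineDatumThree_of_cert_of_delta _ (by norm_num [Δ, b₂, b₄, b₆, b₈]) 15 985 5
    (by simp only [Ψ₃, eval_add, eval_mul, eval_pow, eval_C, eval_X, eval_ofNat]; norm_num [b₂, b₄, b₆, b₈])
    (X2.CellACertN9.squarefree_of_nodup_primeFactorsList_natAbs (by norm_num) (by simp [Nat.primeFactorsList_ofNat])) (by norm_num)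
    (by rw [KernelDisc.eval_Ψ₂Sq]; norm_num [b₂, b₄, b₆]) (by decide) (by decide) (by decide)

/-- `310464ij2` = `[0,0,0,-155820,23434544]` (class `310464ij`, (G-ord, `e = 2`) at `3`; twist `34496f2`, `a₃(V) = -1`, non-anomalous; even line
`φ = χ_{2}`): `x₀ = 294`, `D = 2`, `s = 2464`, `Ψ₂Sq(x₀) = 12142592` ⇒ `X3LineDatumThree W`. [folklore] -/
theorem x3LineDatumThree_310464ij2 : X3LineDatumThree (⟨0, 0, 0, -155820, 23434544⟩ : WeierstrassCurve ℚ) :=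
  x3LineDatumThree_of_cert_of_delta _ (by norm_num [Δ, b₂, b₄, b₆, b₈]) 294 2464 2
    (by simp only [Ψ₃, eval_add, eval_mul, eval_pow, eval_C, eval_X, eval_ofNat]; norm_num [b₂, b₄, b₆, b₈])
    Int.prime_two.squarefree (by norm_num)
    (by rw [KernelDisc.eval_Ψ₂Sq]; norm_num [b₂, b₄, b₆]) (by decide) (by decide) (by decide)

/-- `313650eq2` = `[1,-1,1,-49640,-47568693]` (class `313650eq`, (G-ord, `e = 2`) at `3`; twist `34850h2`, `a₃(V) = 2`, non-anomalous; even line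
`φ = χ_{5}`): `x₀ = 634`, `D = 5`, `s = 11849`, `Ψ₂Sq(x₀) = 701994005` ⇒ `X3LineDatumThree W`. [folklore] -/
theorem x3LineDatumThree_313650eq2 : X3LineDatumThree (⟨1, -1, 1, -49640, -47568693⟩ : WeierstrassCurve ℚ) :=
  x3LineDatumThree_of_cert_of_delta _ (by norm_num [Δ, b₂, b₄, b₆, b₈]) 634 11849 5
    (by simp only [Ψ₃, eval_add, eval_mul, eval_pow, eval_C, eval_X, eval_ofNat]; norm_num [b₂, b₄, b₆, b₈])
    (X2.CellACertN9.squarefree_of_nodup_primeFactorsList_natAbs (by norm_num) (by simp [Nat.primeFactorsList_ofNat])) (by norm_num)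
    (by rw [KernelDisc.eval_Ψ₂Sq]; norm_num [b₂, b₄, b₆]) (by decide) (by decide) (by decide)

/-- `313920c2` = `[0,0,0,-251554188,1534915024112]` (class `313920c`, (G-ord, `e = 2`) at `3`; twist `34880l2`, `a₃(V) = -1`, non-anomalous; even line
`φ = χ_{2}`): `x₀ = 10086`, `D = 2`, `s = 218000`, `Ψ₂Sq(x₀) = 95048000000` ⇒ `X3LineDatumThree W`. [folklore] -/
theorem x3LineDatumThree_313920c2 : X3LineDatumThree (⟨0, 0, 0, -251554188, 1534915024112⟩ : WeierstrassCurve ℚ) :=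
  x3LineDatumThree_of_cert_of_delta _ (by norm_num [Δ, b₂, b₄, b₆, b₈]) 10086 218000 2
    (by simp only [Ψ₃, eval_add, eval_mul, eval_pow, eval_C, eval_X, eval_ofNat]; norm_num [b₂, b₄, b₆, b₈])
    Int.prime_two.squarefree (by norm_num)
    (by rw [KernelDisc.eval_Ψ₂Sq]; norm_num [b₂, b₄, b₆]) (by decide) (by decide) (by decide)

/-- `314100e2` = `[0,0,0,-1927200,1026276500]` (class `314100e`, (G-ord, `e = 2`) at `3`; twist `34900d2`, `a₃(V) = -1`, non-anomalous; even line
`φ = χ_{5}`): `x₀ = 960`, `D = 5`, `s = 6980`, `Ψ₂Sq(x₀) = 243602000` ⇒ `X3LineDatumThree W`. [folklore] -/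
theorem x3LineDatumThree_314100e2 : X3LineDatumThree (⟨0, 0, 0, -1927200, 1026276500⟩ : WeierstrassCurve ℚ) :=
  x3LineDatumThree_of_cert_of_delta _ (by norm_num [Δ, b₂, b₄, b₆, b₈]) 960 6980 5
    (by simp only [Ψ₃, eval_add, eval_mul, eval_pow, eval_C, eval_X, eval_ofNat]; norm_num [b₂, b₄, b₆, b₈])
    (X2.CellACertN9.squarefree_of_nodup_primeFactorsList_natAbs (by norm_num) (by simp [Nat.primeFactorsList_ofNat])) (by norm_num)
    (by rw [KernelDisc.eval_Ψ₂Sq]; norm_num [b₂, b₄, b₆]) (by decide) (by decide) (by decide)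

/-- `316350do2` = `[1,-1,1,-539259755,-26130558422253]` (class `316350do`, (G-ord, `e = 2`) at `3`; twist `35150f2`, `a₃(V) = -1`, non-anomalous; even line
`φ = χ_{5}`): `x₀ = 54904`, `D = 5`, `s = 9370805`, `Ψ₂Sq(x₀) = 439059931740125` ⇒ `X3LineDatumThree W`. [folklore] -/
theorem x3LineDatumThree_316350do2 : X3LineDatumThree (⟨1, -1, 1, -539259755, -26130558422253⟩ : WeierstrassCurve ℚ) :=
  x3LineDatumThree_of_cert_of_delta _ (by norm_num [Δ, b₂, b₄, b₆, b₈]) 54904 9370805 5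
    (by simp only [Ψ₃, eval_add, eval_mul, eval_pow, eval_C, eval_X, eval_ofNat]; norm_num [b₂, b₄, b₆, b₈])
    (X2.CellACertN9.squarefree_of_nodup_primeFactorsList_natAbs (by norm_num) (by simp [Nat.primeFactorsList_ofNat])) (by norm_num)
    (by rw [KernelDisc.eval_Ψ₂Sq]; norm_num [b₂, b₄, b₆]) (by decide) (by decide) (by decide)

/-- `317889u2` = `[0,0,1,-1313130,-414817218]` (class `317889u`, (G-ord, `e = 2`) at `3`; twist `35321c2`, `a₃(V) = -2` — ANOMALOUS (outside the end state as typed); even line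
`φ = χ_{13}`): `x₀ = 1911`, `D = 13`, `s = 35321`, `Ψ₂Sq(x₀) = 16218449533` ⇒ `X3LineDatumThree W`. [folklore] -/
theorem x3LineDatumThree_317889u2 : X3LineDatumThree (⟨0, 0, 1, -1313130, -414817218⟩ : WeierstrassCurve ℚ) :=
  x3LineDatumThree_of_cert_of_delta _ (by norm_num [Δ, b₂, b₄, b₆, b₈]) 1911 35321 13
    (by simp only [Ψ₃, eval_add, eval_mul, eval_pow, eval_C, eval_X, eval_ofNat]; norm_num [b₂, b₄, b₆, b₈])
    (X2.CellACertN9.squarefree_of_nodup_primeFactorsList_natAbs (by norm_num) (by simp [Nat.primeFactorsList_ofNat])) (by norm_num)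
    (by rw [KernelDisc.eval_Ψ₂Sq]; norm_num [b₂, b₄, b₆]) (by decide) (by decide) (by decide)

/-- `318150de2` = `[1,-1,1,-16006055,24651558447]` (class `318150de`, (G-ord, `e = 2`) at `3`; twist `35350b2`, `a₃(V) = 2`, non-anomalous; even line
`φ = χ_{5}`): `x₀ = 2344`, `D = 5`, `s = 2525`, `Ψ₂Sq(x₀) = 31878125` ⇒ `X3LineDatumThree W`. [folklore] -/
theorem x3LineDatumThree_318150de2 : X3LineDatumThree (⟨1, -1, 1, -16006055, 24651558447⟩ : WeierstrassCurve ℚ) :=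
  x3LineDatumThree_of_cert_of_delta _ (by norm_num [Δ, b₂, b₄, b₆, b₈]) 2344 2525 5
    (by simp only [Ψ₃, eval_add, eval_mul, eval_pow, eval_C, eval_X, eval_ofNat]; norm_num [b₂, b₄, b₆, b₈])
    (X2.CellACertN9.squarefree_of_nodup_primeFactorsList_natAbs (by norm_num) (by simp [Nat.primeFactorsList_ofNat])) (by norm_num)
    (by rw [KernelDisc.eval_Ψ₂Sq]; norm_num [b₂, b₄, b₆]) (by decide) (by decide) (by decide)

/-- `318402bf2` = `[1,-1,0,-41022,3213972]` (class `318402bf`, (G-ord, `e = 2`) at `3`; twist `35378n2`, `a₃(V) = 1` — ANOMALOUS (outside the end state as typed); even line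
`φ = χ_{133}`): `x₀ = 100`, `D = 133`, `s = 56`, `Ψ₂Sq(x₀) = 417088` ⇒ `X3LineDatumThree W`. [folklore] -/
theorem x3LineDatumThree_318402bf2 : X3LineDatumThree (⟨1, -1, 0, -41022, 3213972⟩ : WeierstrassCurve ℚ) :=
  x3LineDatumThree_of_cert_of_delta _ (by norm_num [Δ, b₂, b₄, b₆, b₈]) 100 56 133
    (by simp only [Ψ₃, eval_add, eval_mul, eval_pow, eval_C, eval_X, eval_ofNat]; norm_num [b₂, b₄, b₆, b₈])
    (X2.CellACertN9.squarefree_of_nodup_primeFactorsList_natAbs (by norm_num) (by simp [Nat.primeFactorsList_ofNat])) (by norm_num)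
    (by rw [KernelDisc.eval_Ψ₂Sq]; norm_num [b₂, b₄, b₆]) (by decide) (by decide) (by decide)

/-- `318402bh3` = `[1,-1,0,713088,388815552]` (class `318402bh`, (G-ord, `e = 2`) at `3`; twist `35378p3`, `a₃(V) = -2` — ANOMALOUS (outside the end state as typed); even line
`φ = χ_{133}`): `x₀ = 100`, `D = 133`, `s = 3724`, `Ψ₂Sq(x₀) = 1844467408` ⇒ `X3LineDatumThree W`. [folklore] -/
theorem x3LineDatumThree_318402bh3 : X3LineDatumThree (⟨1, -1, 0, 713088, 388815552⟩ : WeierstrassCurve ℚ) :=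
  x3LineDatumThree_of_cert_of_delta _ (by norm_num [Δ, b₂, b₄, b₆, b₈]) 100 3724 133
    (by simp only [Ψ₃, eval_add, eval_mul, eval_pow, eval_C, eval_X, eval_ofNat]; norm_num [b₂, b₄, b₆, b₈])
    (X2.CellACertN9.squarefree_of_nodup_primeFactorsList_natAbs (by norm_num) (by simp [Nat.primeFactorsList_ofNat])) (by norm_num)
    (by rw [KernelDisc.eval_Ψ₂Sq]; norm_num [b₂, b₄, b₆]) (by decide) (by decide) (by decide)

/-- `318402bo2` = `[1,-1,0,1509093,-5682951387]` (class `318402bo`, (G-ord, `e = 2`) at `3`; twist `35378o2`, `a₃(V) = 1` — ANOMALOUS (outside the end state as typed); even line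
`φ = χ_{133}`): `x₀ = 2494`, `D = 133`, `s = 20216`, `Ψ₂Sq(x₀) = 54355325248` ⇒ `X3LineDatumThree W`. [folklore] -/
theorem x3LineDatumThree_318402bo2 : X3LineDatumThree (⟨1, -1, 0, 1509093, -5682951387⟩ : WeierstrassCurve ℚ) :=
  x3LineDatumThree_of_cert_of_delta _ (by norm_num [Δ, b₂, b₄, b₆, b₈]) 2494 20216 133
    (by simp only [Ψ₃, eval_add, eval_mul, eval_pow, eval_C, eval_X, eval_ofNat]; norm_num [b₂, b₄, b₆, b₈])
    (X2.CellACertN9.squarefree_of_nodup_primeFactorsList_natAbs (by norm_num) (by simp [Nat.primeFactorsList_ofNat])) (by norm_num)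
    (by rw [KernelDisc.eval_Ψ₂Sq]; norm_num [b₂, b₄, b₆]) (by decide) (by decide) (by decide)

/-- `318402k2` = `[1,-1,0,27140454,-82968191244]` (class `318402k`, (G-ord, `e = 2`) at `3`; twist `35378q2`, `a₃(V) = -2` — ANOMALOUS (outside the end state as typed); even line
`φ = χ_{133}`): `x₀ = 4888`, `D = 133`, `s = 70756`, `Ψ₂Sq(x₀) = 665852734288` ⇒ `X3LineDatumThree W`. [folklore] -/
theorem x3LineDatumThree_318402k2 : X3LineDatumThree (⟨1, -1, 0, 27140454, -82968191244⟩ : WeierstrassCurve ℚ) :=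
  x3LineDatumThree_of_cert_of_delta _ (by norm_num [Δ, b₂, b₄, b₆, b₈]) 4888 70756 133
    (by simp only [Ψ₃, eval_add, eval_mul, eval_pow, eval_C, eval_X, eval_ofNat]; norm_num [b₂, b₄, b₆, b₈])
    (X2.CellACertN9.squarefree_of_nodup_primeFactorsList_natAbs (by norm_num) (by simp [Nat.primeFactorsList_ofNat])) (by norm_num)
    (by rw [KernelDisc.eval_Ψ₂Sq]; norm_num [b₂, b₄, b₆]) (by decide) (by decide) (by decide)

/-- `320346a2` = `[1,-1,0,-55701,10098621]` (class `320346a`, (G-ord, `e = 2`) at `3`; twist `35594d2`, `a₃(V) = 1` — ANOMALOUS (outside the end state as typed); even line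
`φ = χ_{37}`): `x₀ = 28`, `D = 37`, `s = 962`, `Ψ₂Sq(x₀) = 34241428` ⇒ `X3LineDatumThree W`. [folklore] -/
theorem x3LineDatumThree_320346a2 : X3LineDatumThree (⟨1, -1, 0, -55701, 10098621⟩ : WeierstrassCurve ℚ) :=
  x3LineDatumThree_of_cert_of_delta _ (by norm_num [Δ, b₂, b₄, b₆, b₈]) 28 962 37
    (by simp only [Ψ₃, eval_add, eval_mul, eval_pow, eval_C, eval_X, eval_ofNat]; norm_num [b₂, b₄, b₆, b₈])
    (X2.CellACertN9.squarefree_of_nodup_primeFactorsList_natAbs (by norm_num) (by simp [Nat.primeFactorsList_ofNat])) (by norm_num)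
    (by rw [KernelDisc.eval_Ψ₂Sq]; norm_num [b₂, b₄, b₆]) (by decide) (by decide) (by decide)

/-- `320832v2` = `[0,0,0,199860,6357872]` (class `320832v`, (G-ord, `e = 2`) at `3`; twist `35648d2`, `a₃(V) = -1`, non-anomalous; even line
`φ = χ_{2}`): `x₀ = 150`, `D = 2`, `s = 8912`, `Ψ₂Sq(x₀) = 158847488` ⇒ `X3LineDatumThree W`. [folklore] -/
theorem x3LineDatumThree_320832v2 : X3LineDatumThree (⟨0, 0, 0, 199860, 6357872⟩ : WeierstrassCurve ℚ) :=
  x3LineDatumThree_of_cert_of_delta _ (by norm_num [Δ, b₂, b₄, b₆, b₈]) 150 8912 2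
    (by simp only [Ψ₃, eval_add, eval_mul, eval_pow, eval_C, eval_X, eval_ofNat]; norm_num [b₂, b₄, b₆, b₈])
    Int.prime_two.squarefree (by norm_num)
    (by rw [KernelDisc.eval_Ψ₂Sq]; norm_num [b₂, b₄, b₆]) (by decide) (by decide) (by decide)

/-- `321984bw2` = `[0,0,0,116340,-19618576]` (class `321984bw`, (G-ord, `e = 2`) at `3`; twist `35776b2`, `a₃(V) = -1`, non-anomalous; even line
`φ = χ_{2}`): `x₀ = 294`, `D = 2`, `s = 8944`, `Ψ₂Sq(x₀) = 159990272` ⇒ `X3LineDatumThree W`. [folklore] -/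
theorem x3LineDatumThree_321984bw2 : X3LineDatumThree (⟨0, 0, 0, 116340, -19618576⟩ : WeierstrassCurve ℚ) :=
  x3LineDatumThree_of_cert_of_delta _ (by norm_num [Δ, b₂, b₄, b₆, b₈]) 294 8944 2
    (by simp only [Ψ₃, eval_add, eval_mul, eval_pow, eval_C, eval_X, eval_ofNat]; norm_num [b₂, b₄, b₆, b₈])
    Int.prime_two.squarefree (by norm_num)
    (by rw [KernelDisc.eval_Ψ₂Sq]; norm_num [b₂, b₄, b₆]) (by decide) (by decide) (by decide)

/-- `322452p2` = `[0,0,0,3705,-57746]` (class `322452p`, (G-ord, `e = 2`) at `3`; twist `35828d2`, `a₃(V) = 1` — ANOMALOUS (outside the end state as typed); even line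
`φ = χ_{13}`): `x₀ = 39`, `D = 13`, `s = 212`, `Ψ₂Sq(x₀) = 584272` ⇒ `X3LineDatumThree W`. [folklore] -/
theorem x3LineDatumThree_322452p2 : X3LineDatumThree (⟨0, 0, 0, 3705, -57746⟩ : WeierstrassCurve ℚ) :=
  x3LineDatumThree_of_cert_of_delta _ (by norm_num [Δ, b₂, b₄, b₆, b₈]) 39 212 13
    (by simp only [Ψ₃, eval_add, eval_mul, eval_pow, eval_C, eval_X, eval_ofNat]; norm_num [b₂, b₄, b₆, b₈])
    (X2.CellACertN9.squarefree_of_nodup_primeFactorsList_natAbs (by norm_num) (by simp [Nat.primeFactorsList_ofNat])) (by norm_num)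
    (by rw [KernelDisc.eval_Ψ₂Sq]; norm_num [b₂, b₄, b₆]) (by decide) (by decide) (by decide)

/-- `325494bl2` = `[1,-1,1,-27410,6561533]` (class `325494bl`, (G-ord, `e = 2`) at `3`; twist `36166b2`, `a₃(V) = 1` — ANOMALOUS (outside the end state as typed); even line
`φ = χ_{13}`): `x₀ = 10`, `D = 13`, `s = 1391`, `Ψ₂Sq(x₀) = 25153453` ⇒ `X3LineDatumThree W`. [folklore] -/
theorem x3LineDatumThree_325494bl2 : X3LineDatumThree (⟨1, -1, 1, -27410, 6561533⟩ : WeierstrassCurve ℚ) :=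
  x3LineDatumThree_of_cert_of_delta _ (by norm_num [Δ, b₂, b₄, b₆, b₈]) 10 1391 13
    (by simp only [Ψ₃, eval_add, eval_mul, eval_pow, eval_C, eval_X, eval_ofNat]; norm_num [b₂, b₄, b₆, b₈])
    (X2.CellACertN9.squarefree_of_nodup_primeFactorsList_natAbs (by norm_num) (by simp [Nat.primeFactorsList_ofNat])) (by norm_num)
    (by rw [KernelDisc.eval_Ψ₂Sq]; norm_num [b₂, b₄, b₆]) (by decide) (by decide) (by decide)

/-- `328950cs2` = `[1,-1,0,-547542,156065116]` (class `328950cs`, (G-ord, `e = 2`) at `3`; twist `36550t2`, `a₃(V) = 2`, non-anomalous; even line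
`φ = χ_{5}`): `x₀ = 454`, `D = 5`, `s = 850`, `Ψ₂Sq(x₀) = 3612500` ⇒ `X3LineDatumThree W`. [folklore] -/
theorem x3LineDatumThree_328950cs2 : X3LineDatumThree (⟨1, -1, 0, -547542, 156065116⟩ : WeierstrassCurve ℚ) :=
  x3LineDatumThree_of_cert_of_delta _ (by norm_num [Δ, b₂, b₄, b₆, b₈]) 454 850 5
    (by simp only [Ψ₃, eval_add, eval_mul, eval_pow, eval_C, eval_X, eval_ofNat]; norm_num [b₂, b₄, b₆, b₈])
    (X2.CellACertN9.squarefree_of_nodup_primeFactorsList_natAbs (by norm_num) (by simp [Nat.primeFactorsList_ofNat])) (by norm_num)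
    (by rw [KernelDisc.eval_Ψ₂Sq]; norm_num [b₂, b₄, b₆]) (by decide) (by decide) (by decide)

/-- `328950dv2` = `[1,-1,0,-8712,1705216]` (class `328950dv`, (G-ord, `e = 2`) at `3`; twist `36550v2`, `a₃(V) = 2`, non-anomalous; even line
`φ = χ_{5}`): `x₀ = 4`, `D = 5`, `s = 1156`, `Ψ₂Sq(x₀) = 6681680` ⇒ `X3LineDatumThree W`. [folklore] -/
theorem x3LineDatumThree_328950dv2 : X3LineDatumThree (⟨1, -1, 0, -8712, 1705216⟩ : WeierstrassCurve ℚ) :=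
  x3LineDatumThree_of_cert_of_delta _ (by norm_num [Δ, b₂, b₄, b₆, b₈]) 4 1156 5
    (by simp only [Ψ₃, eval_add, eval_mul, eval_pow, eval_C, eval_X, eval_ofNat]; norm_num [b₂, b₄, b₆, b₈])
    (X2.CellACertN9.squarefree_of_nodup_primeFactorsList_natAbs (by norm_num) (by simp [Nat.primeFactorsList_ofNat])) (by norm_num)
    (by rw [KernelDisc.eval_Ψ₂Sq]; norm_num [b₂, b₄, b₆]) (by decide) (by decide) (by decide)

/-- `329850f2` = `[1,-1,0,-27336042,54842144116]` (class `329850f`, (G-ord, `e = 2`) at `3`; twist `36650m2`, `a₃(V) = -1`, non-anomalous; even line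
`φ = χ_{5}`): `x₀ = 3604`, `D = 5`, `s = 50000`, `Ψ₂Sq(x₀) = 12500000000` ⇒ `X3LineDatumThree W`. [folklore] -/
theorem x3LineDatumThree_329850f2 : X3LineDatumThree (⟨1, -1, 0, -27336042, 54842144116⟩ : WeierstrassCurve ℚ) :=
  x3LineDatumThree_of_cert_of_delta _ (by norm_num [Δ, b₂, b₄, b₆, b₈]) 3604 50000 5
    (by simp only [Ψ₃, eval_add, eval_mul, eval_pow, eval_C, eval_X, eval_ofNat]; norm_num [b₂, b₄, b₆, b₈])
    (X2.CellACertN9.squarefree_of_nodup_primeFactorsList_natAbs (by norm_num) (by simp [Nat.primeFactorsList_ofNat])) (by norm_num)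
    (by rw [KernelDisc.eval_Ψ₂Sq]; norm_num [b₂, b₄, b₆]) (by decide) (by decide) (by decide)

/-- `329850g2` = `[1,-1,0,-12942,-20385284]` (class `329850g`, (G-ord, `e = 2`) at `3`; twist `36650n2`, `a₃(V) = 2`, non-anomalous; even line
`φ = χ_{5}`): `x₀ = 454`, `D = 5`, `s = 7330`, `Ψ₂Sq(x₀) = 268644500` ⇒ `X3LineDatumThree W`. [folklore] -/
theorem x3LineDatumThree_329850g2 : X3LineDatumThree (⟨1, -1, 0, -12942, -20385284⟩ : WeierstrassCurve ℚ) :=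
  x3LineDatumThree_of_cert_of_delta _ (by norm_num [Δ, b₂, b₄, b₆, b₈]) 454 7330 5
    (by simp only [Ψ₃, eval_add, eval_mul, eval_pow, eval_C, eval_X, eval_ofNat]; norm_num [b₂, b₄, b₆, b₈])
    (X2.CellACertN9.squarefree_of_nodup_primeFactorsList_natAbs (by norm_num) (by simp [Nat.primeFactorsList_ofNat])) (by norm_num)
    (by rw [KernelDisc.eval_Ψ₂Sq]; norm_num [b₂, b₄, b₆]) (by decide) (by decide) (by decide)

/-- `331200eq2` = `[0,0,0,-16500,997000]` (class `331200eq`, (G-ord, `e = 2`) at `3`; twist `36800u2`, `a₃(V) = 1` — ANOMALOUS (outside the end state as typed); even line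
`φ = χ_{10}`): `x₀ = 30`, `D = 10`, `s = 460`, `Ψ₂Sq(x₀) = 2116000` ⇒ `X3LineDatumThree W`. [folklore] -/
theorem x3LineDatumThree_331200eq2 : X3LineDatumThree (⟨0, 0, 0, -16500, 997000⟩ : WeierstrassCurve ℚ) :=
  x3LineDatumThree_of_cert_of_delta _ (by norm_num [Δ, b₂, b₄, b₆, b₈]) 30 460 10
    (by simp only [Ψ₃, eval_add, eval_mul, eval_pow, eval_C, eval_X, eval_ofNat]; norm_num [b₂, b₄, b₆, b₈])
    (X2.CellACertN9.squarefree_of_nodup_primeFactorsList_natAbs (by norm_num) (by simp [Nat.primeFactorsList_ofNat])) (by norm_num)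
    (by rw [KernelDisc.eval_Ψ₂Sq]; norm_num [b₂, b₄, b₆]) (by decide) (by decide) (by decide)

/-- `331200ki2` = `[0,0,0,-997500,379150000]` (class `331200ki`, (G-ord, `e = 2`) at `3`; twist `36800bc2`, `a₃(V) = -2` — ANOMALOUS (outside the end state as typed); even line
`φ = χ_{10}`): `x₀ = 750`, `D = 10`, `s = 4600`, `Ψ₂Sq(x₀) = 211600000` ⇒ `X3LineDatumThree W`. [folklore] -/
theorem x3LineDatumThree_331200ki2 : X3LineDatumThree (⟨0, 0, 0, -997500, 379150000⟩ : WeierstrassCurve ℚ) :=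
  x3LineDatumThree_of_cert_of_delta _ (by norm_num [Δ, b₂, b₄, b₆, b₈]) 750 4600 10
    (by simp only [Ψ₃, eval_add, eval_mul, eval_pow, eval_C, eval_X, eval_ofNat]; norm_num [b₂, b₄, b₆, b₈])
    (X2.CellACertN9.squarefree_of_nodup_primeFactorsList_natAbs (by norm_num) (by simp [Nat.primeFactorsList_ofNat])) (by norm_num)
    (by rw [KernelDisc.eval_Ψ₂Sq]; norm_num [b₂, b₄, b₆]) (by decide) (by decide) (by decide)

/-- `331650eg2` = `[1,-1,1,-294755,65004747]` (class `331650eg`, (G-ord, `e = 2`) at `3`; twist `36850a2`, `a₃(V) = -1`, non-anomalous; even line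
`φ = χ_{5}`): `x₀ = 184`, `D = 5`, `s = 3685`, `Ψ₂Sq(x₀) = 67896125` ⇒ `X3LineDatumThree W`. [folklore] -/
theorem x3LineDatumThree_331650eg2 : X3LineDatumThree (⟨1, -1, 1, -294755, 65004747⟩ : WeierstrassCurve ℚ) :=
  x3LineDatumThree_of_cert_of_delta _ (by norm_num [Δ, b₂, b₄, b₆, b₈]) 184 3685 5
    (by simp only [Ψ₃, eval_add, eval_mul, eval_pow, eval_C, eval_X, eval_ofNat]; norm_num [b₂, b₄, b₆, b₈])
    (X2.CellACertN9.squarefree_of_nodup_primeFactorsList_natAbs (by norm_num) (by simp [Nat.primeFactorsList_ofNat])) (by norm_num)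
    (by rw [KernelDisc.eval_Ψ₂Sq]; norm_num [b₂, b₄, b₆]) (by decide) (by decide) (by decide)

/-- `331650m2` = `[1,-1,0,-33693867,1010722449541]` (class `331650m`, (G-ord, `e = 2`) at `3`; twist `36850s2`, `a₃(V) = 2`, non-anomalous; even line
`φ = χ_{5}`): `x₀ = 94`, `D = 5`, `s = 897800`, `Ψ₂Sq(x₀) = 4030224200000` ⇒ `X3LineDatumThree W`. [folklore] -/
theorem x3LineDatumThree_331650m2 : X3LineDatumThree (⟨1, -1, 0, -33693867, 1010722449541⟩ : WeierstrassCurve ℚ) :=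
  x3LineDatumThree_of_cert_of_delta _ (by norm_num [Δ, b₂, b₄, b₆, b₈]) 94 897800 5
    (by simp only [Ψ₃, eval_add, eval_mul, eval_pow, eval_C, eval_X, eval_ofNat]; norm_num [b₂, b₄, b₆, b₈])
    (X2.CellACertN9.squarefree_of_nodup_primeFactorsList_natAbs (by norm_num) (by simp [Nat.primeFactorsList_ofNat])) (by norm_num)
    (by rw [KernelDisc.eval_Ψ₂Sq]; norm_num [b₂, b₄, b₆]) (by decide) (by decide) (by decide)

/-- `332550cg2` = `[1,-1,1,-164930,31745697]` (class `332550cg`, (G-ord, `e = 2`) at `3`; twist `36950c2`, `a₃(V) = -1`, non-anomalous; even line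
`φ = χ_{5}`): `x₀ = 94`, `D = 5`, `s = 3695`, `Ψ₂Sq(x₀) = 68265125` ⇒ `X3LineDatumThree W`. [folklore] -/
theorem x3LineDatumThree_332550cg2 : X3LineDatumThree (⟨1, -1, 1, -164930, 31745697⟩ : WeierstrassCurve ℚ) :=
  x3LineDatumThree_of_cert_of_delta _ (by norm_num [Δ, b₂, b₄, b₆, b₈]) 94 3695 5
    (by simp only [Ψ₃, eval_add, eval_mul, eval_pow, eval_C, eval_X, eval_ofNat]; norm_num [b₂, b₄, b₆, b₈])
    (X2.CellACertN9.squarefree_of_nodup_primeFactorsList_natAbs (by norm_num) (by simp [Nat.primeFactorsList_ofNat])) (by norm_num)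
    (by rw [KernelDisc.eval_Ψ₂Sq]; norm_num [b₂, b₄, b₆]) (by decide) (by decide) (by decide)

/-- `332838a2` = `[1,-1,0,1149489,-1648397399]` (class `332838a`, (G-ord, `e = 2`) at `3`; twist `36982g2`, `a₃(V) = 2`, non-anomalous; even line
`φ = χ_{41}`): `x₀ = 1507`, `D = 41`, `s = 18491`, `Ψ₂Sq(x₀) = 14018600321` ⇒ `X3LineDatumThree W`. [folklore] -/
theorem x3LineDatumThree_332838a2 : X3LineDatumThree (⟨1, -1, 0, 1149489, -1648397399⟩ : WeierstrassCurve ℚ) :=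
  x3LineDatumThree_of_cert_of_delta _ (by norm_num [Δ, b₂, b₄, b₆, b₈]) 1507 18491 41
    (by simp only [Ψ₃, eval_add, eval_mul, eval_pow, eval_C, eval_X, eval_ofNat]; norm_num [b₂, b₄, b₆, b₈])
    (X2.CellACertN9.squarefree_of_nodup_primeFactorsList_natAbs (by norm_num) (by simp [Nat.primeFactorsList_ofNat])) (by norm_num)
    (by rw [KernelDisc.eval_Ψ₂Sq]; norm_num [b₂, b₄, b₆]) (by decide) (by decide) (by decide)

/-- `332838cj2` = `[1,-1,1,-18581,1218669]` (class `332838cj`, (G-ord, `e = 2`) at `3`; twist `36982a2`, `a₃(V) = -1`, non-anomalous; even line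
`φ = χ_{41}`): `x₀ = 31`, `D = 41`, `s = 256`, `Ψ₂Sq(x₀) = 2686976` ⇒ `X3LineDatumThree W`. [folklore] -/
theorem x3LineDatumThree_332838cj2 : X3LineDatumThree (⟨1, -1, 1, -18581, 1218669⟩ : WeierstrassCurve ℚ) :=
  x3LineDatumThree_of_cert_of_delta _ (by norm_num [Δ, b₂, b₄, b₆, b₈]) 31 256 41
    (by simp only [Ψ₃, eval_add, eval_mul, eval_pow, eval_C, eval_X, eval_ofNat]; norm_num [b₂, b₄, b₆, b₈])
    (X2.CellACertN9.squarefree_of_nodup_primeFactorsList_natAbs (by norm_num) (by simp [Nat.primeFactorsList_ofNat])) (by norm_num)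
    (by rw [KernelDisc.eval_Ψ₂Sq]; norm_num [b₂, b₄, b₆]) (by decide) (by decide) (by decide)

end Summit.BirchSwinnertonDyer.Rank1Residual.Additive.X3ThreeLineDatumRecords
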